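import Summits.BirchSwinnertonDyer.BirchSwinnertonDyer.Theorems.ThetaPartnerAtTwoSignedKatoUpToAtTwoHondaLogCharSum
import Summits.BirchSwinnertonDyer.BirchSwinnertonDyer.Theorems.PrintX8VSInputHondaSystemSprungTowerPoints
import HarnessLib

/-!
# Crux `SupersingularRankZeroAtTwo` (K4, item stmt-BirchSwinnertonDyer-19097), line `odd_blind_package` v2.19, `stub_flatPackage`
# conjunct (8), F3 — FILE E1a: the CHARACTER SUMS OF SPRUNG'S TOWER LOGARITHMS `ℓ_m(x) = ∑_{k<m} x_k (ζ_{p^{m−k}} − 1)` are Gauss sums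
# (Kobayashi Prop. 8.26 for a general Honda type `p − aT + T²`, any prime `p`)

Seat `bsd-2adic-tower-1` GEN 69, hand «hF3-ERL» (pen GEN 41 SUMMON 20260831T215831Z, director-bsd (979) slot 2). HONEST FRAMING:
theorems only (no definition, no named fact, no instance, no `sorry`); cyclotomic algebra in `ℚ̄_p` and the formal-group logarithm on the
`p`-adic model; helper toward conjunct (8) F3 of `stub_flatPackage`; closes no stub and no item; 19097 OPEN; BSD₂ is proved for no
supersingular curve and BSD for no curve by any of this.

## What

K3's `SignedKatoOffTwo.HondaLog` (line `colemanrat`, `a_p = 0`) computes the character sums of Kobayashi's logarithm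
`ell p m = ∑_{k} (−1)^k(ζ_{m−2k} − 1)/p^k`. The Sprung–Honda system at a supersingular `2` with `a₂ ∈ {0, ±2}` (`SSHondaTwo.sprungPrimal_padic_withLog`,
FILE E0) has tower logarithms `ℓ_m(x) = ∑_{k<m} x_k (ζ_{p^{m−k}} − 1)` with Sprung's sequence `x` (`x_0 = 1`). This file is the `x`-generic twin:

* §1 (`ζ_m^{p^k} = ζ_{m−k}` is `SprungHonda.zeta_pow_prime_pow`) `smul_sprungEll_eq_twisted` (`σ ζ_m = ζ_m^a ⇒ σ•ℓ_m(x) = ℓ_m^{(a)}(x) :=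
  ∑_{k<m} x_k(ζ_{m−k}^a − 1)`), `mul_inverter_smul_sprungEll_eq_twisted`, ★ `sum_mul_twistedSprungEll_eq` (`ψ` PRIMITIVE mod `p^m`, `m ≥ 1`:
  `∑_a ψ(a)·ℓ_m^{(a)}(x) = x_0 · τ(ψ)` — only the shift `k = 0` survives), `sum_mul_twistedSprungEll_neg_eq` (`… = x_0 ψ(−1) τ(ψ)`),
  ★ `sum_mul_flatLog_eq` (`m ≥ 2`: `∑_a ψ(a)·(N(ℓ^{(a)} + ℓ^{(−a)}) − 2·x_0(ζ_1^a − 1)) = N·x_0·(1 + ψ(−1))·τ(ψ)`);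
* §2 (points of the `p`-adic model, abstract coordinatewise Galois action `act`) `ptLogΩ_act_flatPoint`
  (`Λ(act τ (N•(c + act σ c) − 2•c₁)) = τ • (N(L + σ•L) − 2L₁)` for `Λ(c) = L`, `Λ(c₁) = L₁`), `smul_flatLog_eq_twisted`,
  ★ `sum_mul_ptLogΩ_act_flatPoint_eq` (`∑_a ψ(a)·Λ(act τ_a (N•(c + act σ c) − 2•c₁)) = N·x_0·(1+ψ(−1))·τ(ψ)` for `Λ(c) = ℓ_m(x)`, `Λ(c₁) = ℓ_1(x)`).
K3's theorems are the instance `x_{2k} = (−1/p)^k, x_{2k+1} = 0`, `N = 3`.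

References: [Kobayashi2003] S. Kobayashi, Invent. Math. 152 (2003), §8.4 (Lemma 8.9), Prop. 8.26 (p. 25); [Sprung2012] F. Sprung, J. Number
Theory 132 (2012), Thm. 2.2, Lemma 2.3; [Washington1997] Lemma 4.7–4.8; [SilvermanAEC2009] IV.6.4.
-/

set_option autoImplicit false
-- the Theorems namespace of this sub repeats the summit name by design (D-0017 nested layout)
set_option linter.dupNamespace false

noncomputable section

open scoped Classical

open Finset DirichletCharacter
  Summit.BirchSwinnertonDyer.Rank1Residual.Additive
  Summit.BirchSwinnertonDyer.Rank1Residual.Additive.PadicCyclotomicTower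
  Summit.BirchSwinnertonDyer.Rank1Residual.Additive.BallEval
  Summit.BirchSwinnertonDyer.BirchSwinnertonDyer.Theorems.SignedKatoOffTwo.HondaLog

namespace Summit.BirchSwinnertonDyer.BirchSwinnertonDyer.Theorems.SSFlatERL

variable {p : ℕ} [hp : Fact p.Prime]

/-! ## §1 The Galois twist of Sprung's logarithm and its character sums -/

/-- `ζ_{m−k}^{a} = ζ_m^{((p^k : ℤ/p^m)·a).val}`. [folklore] -/
theorem zeta_sub_pow_val_eq' (m k : ℕ) (a : ZMod (p ^ m)) :
    zeta p (m - k) ^ a.val = zeta p m ^ (((p ^ k : ℕ) : ZMod (p ^ m)) * a).val := by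
  haveI : NeZero (p ^ m) := ⟨pow_ne_zero m hp.out.ne_zero⟩
  rw [← SprungHonda.zeta_pow_prime_pow m k, ← pow_mul, pow_eq_pow_mod (p ^ k * a.val) (zeta_pow_prime_pow_self m), ZMod.val_mul,
    ZMod.val_natCast, Nat.mod_mul_mod]

/-- **The Galois twist of Sprung's logarithm**: if `σ ζ_m = ζ_m^a` then `σ • ℓ_m(x) = ∑_{k<m} x_k (ζ_{m−k}^a − 1)` (`x_k ∈ ℚ_p` is fixed,
`σ ζ_{m−k} = σ ζ_m^{p^k} = ζ_{m−k}^a`). [cite: Kobayashi2003, §8.4 (Lemma 8.9), Prop. 8.26] [cite: Sprung2012, Lemma 2.3] -/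
theorem smul_sprungEll_eq_twisted (x : ℕ → ℚ_[p]) (σ : Field.absoluteGaloisGroup ℚ_[p]) (m : ℕ) {a : ℕ}
    (ha : σ • zeta p m = zeta p m ^ a) :
    σ • (∑ k ∈ range m, algebraMap ℚ_[p] (PadicAlgCl p) (x k) * (zeta p (m - k) - 1)) =
      ∑ k ∈ range m, algebraMap ℚ_[p] (PadicAlgCl p) (x k) * (zeta p (m - k) ^ a - 1) := by
  have hζk : ∀ k : ℕ, σ • zeta p (m - k) = zeta p (m - k) ^ a := by
    intro k
    rw [← SprungHonda.zeta_pow_prime_pow (p := p) m k, smul_pow', ha, ← pow_mul, ← pow_mul, mul_comm]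
  rw [Field.absoluteGaloisGroup.smul_def, map_sum]
  refine Finset.sum_congr rfl fun k _ ↦ ?_
  have hk := hζk k
  rw [Field.absoluteGaloisGroup.smul_def] at hk
  rw [map_mul, map_sub, map_one, AlgEquiv.commutes, hk]

/-- **The twist by an inverter composed with `τ_a` is the twist by `−a`** (Sprung logarithm). [cite: Kobayashi2003, §8.4 and Prop. 8.26] -/
theorem mul_inverter_smul_sprungEll_eq_twisted (x : ℕ → ℚ_[p]) {m : ℕ} [NeZero (p ^ m)] {σ τ : Field.absoluteGaloisGroup ℚ_[p]}
    (hσ : σ • zeta p m = (zeta p m)⁻¹) {a : ZMod (p ^ m)} (hτ : τ • zeta p m = zeta p m ^ a.val) :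
    (τ * σ) • (∑ k ∈ range m, algebraMap ℚ_[p] (PadicAlgCl p) (x k) * (zeta p (m - k) - 1)) =
      ∑ k ∈ range m, algebraMap ℚ_[p] (PadicAlgCl p) (x k) * (zeta p (m - k) ^ (-a).val - 1) := by
  refine smul_sprungEll_eq_twisted x (τ * σ) m ?_
  have e_neg : zeta p m ^ (-a).val = (zeta p m ^ a.val)⁻¹ := by
    have h := AddChar.map_neg_eq_inv (AddChar.zmodChar (p ^ m) (zeta_pow_prime_pow_self (p := p) m)) a
    rwa [AddChar.zmodChar_apply, AddChar.zmodChar_apply] at h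
  rw [mul_smul, hσ, smul_inv'', hτ, e_neg]

/-- **The character sums of the twisted Sprung logarithms are Gauss sums**: for `m ≥ 1` and a PRIMITIVE `ψ` modulo `p^m`,
`∑_a ψ(a)·(∑_{k<m} x_k (ζ_{m−k}^a − 1)) = x_0 · ∑_a ψ(a) ζ_m^a` — for `k ≥ 1`, `∑_a ψ(a) ζ_m^{p^k a} = ψ̄(p^k) τ(ψ) = 0` (`p^k` is not a unit),
and `∑_a ψ(a) = 0`. [cite: Kobayashi2003, Prop. 8.26 (p. 25)] [cite: Washington1997, Lemma 4.7–4.8] -/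
theorem sum_mul_twistedSprungEll_eq (x : ℕ → ℚ_[p]) {m : ℕ} (hm : 1 ≤ m) [NeZero (p ^ m)]
    (ψ : DirichletCharacter (PadicAlgCl p) (p ^ m)) (hψ : ψ.IsPrimitive) :
    ∑ a : ZMod (p ^ m), ψ a * ∑ k ∈ range m, algebraMap ℚ_[p] (PadicAlgCl p) (x k) * (zeta p (m - k) ^ a.val - 1) =
      algebraMap ℚ_[p] (PadicAlgCl p) (x 0) * gaussSum ψ (AddChar.zmodChar (p ^ m) (zeta_pow_prime_pow_self (p := p) m)) := by
  set e : AddChar (ZMod (p ^ m)) (PadicAlgCl p) := AddChar.zmodChar (p ^ m) (zeta_pow_prime_pow_self (p := p) m) with he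
  have hG : ∀ k : ℕ, ∑ a : ZMod (p ^ m), ψ a * zeta p (m - k) ^ a.val = gaussSum ψ (e.mulShift (((p ^ k : ℕ) : ZMod (p ^ m)))) := by
    intro k
    rw [gaussSum]
    refine Finset.sum_congr rfl fun a _ ↦ ?_
    rw [AddChar.mulShift_apply, he, AddChar.zmodChar_apply, zeta_sub_pow_val_eq']
  have hG0 : ∑ a : ZMod (p ^ m), ψ a * zeta p (m - 0) ^ a.val = gaussSum ψ e := by
    rw [hG 0, pow_zero, Nat.cast_one, AddChar.mulShift_one]
  have hGk : ∀ k : ℕ, 1 ≤ k → ∑ a : ZMod (p ^ m), ψ a * zeta p (m - k) ^ a.val = 0 := by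
    intro k hk
    rw [hG k, gaussSum_mulShift_of_isPrimitive _ hψ, MulChar.map_nonunit _ (not_isUnit_prime_pow_cast' hm hk), zero_mul]
  have hψ0 : ∑ a : ZMod (p ^ m), ψ a = 0 := MulChar.sum_eq_zero_of_ne_one (ne_one_of_isPrimitive hm hψ)
  have hinner : ∀ k : ℕ, ∑ a : ZMod (p ^ m), ψ a * (algebraMap ℚ_[p] (PadicAlgCl p) (x k) * (zeta p (m - k) ^ a.val - 1)) =
      algebraMap ℚ_[p] (PadicAlgCl p) (x k) * ((∑ a : ZMod (p ^ m), ψ a * zeta p (m - k) ^ a.val) - ∑ a : ZMod (p ^ m), ψ a) := by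
    intro k
    rw [mul_sub, Finset.mul_sum, Finset.mul_sum, ← Finset.sum_sub_distrib]
    refine Finset.sum_congr rfl fun a _ ↦ ?_
    ring
  calc ∑ a : ZMod (p ^ m), ψ a * ∑ k ∈ range m, algebraMap ℚ_[p] (PadicAlgCl p) (x k) * (zeta p (m - k) ^ a.val - 1)
      = ∑ a : ZMod (p ^ m), ∑ k ∈ range m, ψ a * (algebraMap ℚ_[p] (PadicAlgCl p) (x k) * (zeta p (m - k) ^ a.val - 1)) := by
        refine Finset.sum_congr rfl fun a _ ↦ ?_
        rw [Finset.mul_sum]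
    _ = ∑ k ∈ range m, ∑ a : ZMod (p ^ m), ψ a * (algebraMap ℚ_[p] (PadicAlgCl p) (x k) * (zeta p (m - k) ^ a.val - 1)) :=
        Finset.sum_comm
    _ = ∑ k ∈ range m, algebraMap ℚ_[p] (PadicAlgCl p) (x k) *
          ((∑ a : ZMod (p ^ m), ψ a * zeta p (m - k) ^ a.val) - ∑ a : ZMod (p ^ m), ψ a) :=
        Finset.sum_congr rfl fun k _ ↦ hinner k
    _ = algebraMap ℚ_[p] (PadicAlgCl p) (x 0) *
          ((∑ a : ZMod (p ^ m), ψ a * zeta p (m - 0) ^ a.val) - ∑ a : ZMod (p ^ m), ψ a) := by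
        refine Finset.sum_eq_single 0 (fun k hk hk0 ↦ ?_) (fun h ↦ ?_)
        · rw [hGk k (Nat.one_le_iff_ne_zero.mpr hk0), hψ0, sub_zero, mul_zero]
        · exact absurd (Finset.mem_range.mpr (by omega)) h
    _ = algebraMap ℚ_[p] (PadicAlgCl p) (x 0) * gaussSum ψ e := by rw [hG0, hψ0, sub_zero]

/-- **Reindexing by `a ↦ −a`** (Sprung logarithm): `∑_a ψ(a)·ℓ_m^{(−a)}(x) = x_0 · ψ(−1) · τ(ψ)`. [cite: Kobayashi2003, Prop. 8.26 (p. 25)] -/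
theorem sum_mul_twistedSprungEll_neg_eq (x : ℕ → ℚ_[p]) {m : ℕ} (hm : 1 ≤ m) [NeZero (p ^ m)]
    (ψ : DirichletCharacter (PadicAlgCl p) (p ^ m)) (hψ : ψ.IsPrimitive) :
    ∑ a : ZMod (p ^ m), ψ a * ∑ k ∈ range m, algebraMap ℚ_[p] (PadicAlgCl p) (x k) * (zeta p (m - k) ^ (-a).val - 1) =
      algebraMap ℚ_[p] (PadicAlgCl p) (x 0) * (ψ (-1) * gaussSum ψ (AddChar.zmodChar (p ^ m) (zeta_pow_prime_pow_self (p := p) m))) := by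
  have h := sum_mul_twistedSprungEll_eq x hm ψ hψ
  have hre : ∑ a : ZMod (p ^ m), ψ a * ∑ k ∈ range m, algebraMap ℚ_[p] (PadicAlgCl p) (x k) * (zeta p (m - k) ^ (-a).val - 1) =
      ∑ a : ZMod (p ^ m), ψ (-a) * ∑ k ∈ range m, algebraMap ℚ_[p] (PadicAlgCl p) (x k) * (zeta p (m - k) ^ a.val - 1) := by
    rw [← Equiv.sum_comp (Equiv.neg (ZMod (p ^ m)))]
    simp only [Equiv.neg_apply, neg_neg]
  have hψneg : ∀ a : ZMod (p ^ m),
      ψ (-a) * ∑ k ∈ range m, algebraMap ℚ_[p] (PadicAlgCl p) (x k) * (zeta p (m - k) ^ a.val - 1) =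
        ψ (-1) * (ψ a * ∑ k ∈ range m, algebraMap ℚ_[p] (PadicAlgCl p) (x k) * (zeta p (m - k) ^ a.val - 1)) := fun a ↦ by
    rw [← mul_assoc, ← map_mul, neg_one_mul]
  rw [hre, Finset.sum_congr rfl (fun a _ ↦ hψneg a), ← Finset.mul_sum, h]
  ring

/-- **The character sum of the ♭ logarithm combination** (shape of the logarithm of the Sprung–Honda point at `2`,
`d_n = N•(y_m + σ_m•y_m) − 2•y_1`, `m = n + 2`, `Λ(y_m) = ℓ_m(x)`, `ℓ_1(x) = x_0(ζ_1 − 1)`): for `m ≥ 2` and a primitive `ψ` modulo `p^m`,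
`∑_a ψ(a)·(N(ℓ_m^{(a)} + ℓ_m^{(−a)}) − 2·x_0(ζ_1^{a} − 1)) = N · x_0 · (1 + ψ(−1)) · τ(ψ)` (the `ℓ_1`-term dies: `ζ_1 = ζ_m^{p^{m−1}}` is an
imprimitive shift). K3's `HondaLog.sum_mul_plusLog_eq` is `N = 3` with Kobayashi's `x`. [cite: Kobayashi2003, Prop. 8.26 (p. 25)] [cite: Sprung2012, Lemma 2.3] -/
theorem sum_mul_flatLog_eq (x : ℕ → ℚ_[p]) (N : ℕ) {m : ℕ} (hm : 2 ≤ m) [NeZero (p ^ m)]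
    (ψ : DirichletCharacter (PadicAlgCl p) (p ^ m)) (hψ : ψ.IsPrimitive) :
    ∑ a : ZMod (p ^ m), ψ a *
        ((N : PadicAlgCl p) * ((∑ k ∈ range m, algebraMap ℚ_[p] (PadicAlgCl p) (x k) * (zeta p (m - k) ^ a.val - 1)) +
              ∑ k ∈ range m, algebraMap ℚ_[p] (PadicAlgCl p) (x k) * (zeta p (m - k) ^ (-a).val - 1)) -
          2 * (algebraMap ℚ_[p] (PadicAlgCl p) (x 0) * (zeta p 1 ^ a.val - 1))) =
      (N : PadicAlgCl p) * algebraMap ℚ_[p] (PadicAlgCl p) (x 0) * (1 + ψ (-1)) *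
        gaussSum ψ (AddChar.zmodChar (p ^ m) (zeta_pow_prime_pow_self (p := p) m)) := by
  set e : AddChar (ZMod (p ^ m)) (PadicAlgCl p) := AddChar.zmodChar (p ^ m) (zeta_pow_prime_pow_self (p := p) m) with he
  have hm1 : 1 ≤ m := by omega
  -- the `ℓ_1`-term: `Σ_a ψ(a) ζ_1^a = τ(ψ, shift p^{m−1}) = 0`, `Σ_a ψ(a) = 0`
  have hζ1 : ∀ a : ZMod (p ^ m), zeta p 1 ^ a.val = e ((((p ^ (m - 1) : ℕ) : ZMod (p ^ m))) * a) := by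
    intro a
    rw [he, AddChar.zmodChar_apply]
    have h1 : zeta p 1 = zeta p m ^ p ^ (m - 1) := by
      rw [SprungHonda.zeta_pow_prime_pow, show m - (m - 1) = 1 by omega]
    rw [h1, ← pow_mul, pow_eq_pow_mod (p ^ (m - 1) * a.val) (zeta_pow_prime_pow_self m), ZMod.val_mul,
      ZMod.val_natCast, Nat.mod_mul_mod]
  have hsum1 : ∑ a : ZMod (p ^ m), ψ a * (algebraMap ℚ_[p] (PadicAlgCl p) (x 0) * (zeta p 1 ^ a.val - 1)) = 0 := by
    have hA : ∑ a : ZMod (p ^ m), ψ a * zeta p 1 ^ a.val = 0 := by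
      have hG : ∑ a : ZMod (p ^ m), ψ a * zeta p 1 ^ a.val = gaussSum ψ (e.mulShift (((p ^ (m - 1) : ℕ) : ZMod (p ^ m)))) := by
        rw [gaussSum]
        exact Finset.sum_congr rfl fun a _ ↦ by rw [AddChar.mulShift_apply, hζ1]
      rw [hG, gaussSum_mulShift_of_isPrimitive _ hψ, MulChar.map_nonunit _ (not_isUnit_prime_pow_cast' hm1 (by omega)),
        zero_mul]
    have hB : ∑ a : ZMod (p ^ m), ψ a = 0 := MulChar.sum_eq_zero_of_ne_one (ne_one_of_isPrimitive hm1 hψ)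
    calc ∑ a : ZMod (p ^ m), ψ a * (algebraMap ℚ_[p] (PadicAlgCl p) (x 0) * (zeta p 1 ^ a.val - 1))
        = algebraMap ℚ_[p] (PadicAlgCl p) (x 0) * ((∑ a : ZMod (p ^ m), ψ a * zeta p 1 ^ a.val) - ∑ a : ZMod (p ^ m), ψ a) := by
          rw [mul_sub, Finset.mul_sum, Finset.mul_sum, ← Finset.sum_sub_distrib]
          exact Finset.sum_congr rfl fun a _ ↦ by ring
      _ = 0 := by rw [hA, hB, sub_zero, mul_zero]
  have hplus := sum_mul_twistedSprungEll_eq x hm1 ψ hψ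
  have hminus := sum_mul_twistedSprungEll_neg_eq x hm1 ψ hψ
  have hsplit : ∑ a : ZMod (p ^ m), ψ a *
        ((N : PadicAlgCl p) * ((∑ k ∈ range m, algebraMap ℚ_[p] (PadicAlgCl p) (x k) * (zeta p (m - k) ^ a.val - 1)) +
              ∑ k ∈ range m, algebraMap ℚ_[p] (PadicAlgCl p) (x k) * (zeta p (m - k) ^ (-a).val - 1)) -
          2 * (algebraMap ℚ_[p] (PadicAlgCl p) (x 0) * (zeta p 1 ^ a.val - 1))) =
      (N : PadicAlgCl p) * (∑ a : ZMod (p ^ m), ψ a * ∑ k ∈ range m, algebraMap ℚ_[p] (PadicAlgCl p) (x k) * (zeta p (m - k) ^ a.val - 1)) +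
        (N : PadicAlgCl p) * (∑ a : ZMod (p ^ m), ψ a * ∑ k ∈ range m, algebraMap ℚ_[p] (PadicAlgCl p) (x k) * (zeta p (m - k) ^ (-a).val - 1)) -
        2 * ∑ a : ZMod (p ^ m), ψ a * (algebraMap ℚ_[p] (PadicAlgCl p) (x 0) * (zeta p 1 ^ a.val - 1)) := by
    rw [Finset.mul_sum, Finset.mul_sum, Finset.mul_sum, ← Finset.sum_add_distrib, ← Finset.sum_sub_distrib]
    exact Finset.sum_congr rfl fun a _ ↦ by ring
  rw [hsplit, hplus, hminus, hsum1, mul_zero, sub_zero]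
  ring

/-! ## §2 The logarithm of the Galois conjugates of `N•(c + σ•c) − 2•c₁` on the `p`-adic model and its character sums -/

section PlusPoint

open WeierstrassCurve Field Literature.NumberTheory.EllipticCurves Literature.NumberTheory.EllipticCurves.FormalGroupChart
  Literature.NumberTheory.GaloisRepresentations

variable {M : WeierstrassCurve ℤ_[p]} [hE : (M.map PadicInt.Coe.ringHom).IsElliptic]
  [hintΩ : (genFibΩ p M).IsIntegral (Valued.v (R := PadicAlgCl p)).integer]

/-- **The logarithm of a Galois conjugate of `N•(c + σ•c) − 2•c₁`** (abstract coordinatewise action `act`, `c ∈ L(m) ∩ E₁` with `Λ(c) = L`,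
`c₁ ∈ L(1) ∩ E₁` with `Λ(c₁) = L₁`, `m ≥ 1`): `Λ(act τ (N•(c + act σ c) − 2•c₁)) = τ • (N(L + σ•L) − 2L₁)`. K3's `HondaLog.ptLogΩ_act_plusPoint` is
`N = 3`, `L = ell p m`. [cite: Kobayashi2003, §8.4 (Lemma 8.9), Prop. 8.26] [cite: SilvermanAEC2009, IV.6.4] -/
theorem ptLogΩ_act_flatPoint
    (act : Field.absoluteGaloisGroup ℚ_[p] → (genFibΩ p M).toAffine.Point → (genFibΩ p M).toAffine.Point)
    (hact0 : ∀ σ, act σ 0 = 0)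
    (hact : ∀ σ (x y : PadicAlgCl p) (h : (genFibΩ p M).toAffine.Nonsingular x y),
      ∃ h', act σ (Affine.Point.some x y h) = Affine.Point.some (σ • x) (σ • y) h')
    (σ τ : Field.absoluteGaloisGroup ℚ_[p]) (N : ℕ) {m : ℕ} (hm : 1 ≤ m) {c c₁ : (genFibΩ p M).toAffine.Point} {L L₁ : PadicAlgCl p}
    (hcL : c ∈ subfieldPoints (genFibΩ p M) (layer p m).toSubfield coeffs_mem_layer)
    (hck : c ∈ kernel (Valued.v (R := PadicAlgCl p)) (genFibΩ p M)) (hcℓ : ptLogΩ p M c = L)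
    (hc₁L : c₁ ∈ subfieldPoints (genFibΩ p M) (layer p 1).toSubfield coeffs_mem_layer)
    (hc₁k : c₁ ∈ kernel (Valued.v (R := PadicAlgCl p)) (genFibΩ p M)) (hc₁ℓ : ptLogΩ p M c₁ = L₁) :
    ptLogΩ p M (act τ (N • (c + act σ c) - (2 : ℕ) • c₁)) = τ • ((N : PadicAlgCl p) * (L + σ • L) - 2 * L₁) := by
  haveI := isIntegral_curveK p (LayerField p m) M
  have hσcL : act σ c ∈ subfieldPoints (genFibΩ p M) (layer p m).toSubfield coeffs_mem_layer :=
    act_mem_subfieldPoints act hact0 hact σ hcL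
  have hσck : act σ c ∈ kernel (Valued.v (R := PadicAlgCl p)) (genFibΩ p M) := act_mem_kernel act hact0 hact σ hck
  have hc₁L' : c₁ ∈ subfieldPoints (genFibΩ p M) (layer p m).toSubfield coeffs_mem_layer :=
    subfieldPoints_layer_mono hm hc₁L
  have hsumL : c + act σ c ∈ subfieldPoints (genFibΩ p M) (layer p m).toSubfield coeffs_mem_layer :=
    (subfieldPoints _ _ _).add_mem hcL hσcL
  have hsumk : c + act σ c ∈ kernel (Valued.v (R := PadicAlgCl p)) (genFibΩ p M) :=
    (kernel (Valued.v (R := PadicAlgCl p)) (genFibΩ p M)).add_mem hck hσck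
  have hNL : N • (c + act σ c) ∈ subfieldPoints (genFibΩ p M) (layer p m).toSubfield coeffs_mem_layer :=
    (subfieldPoints _ _ _).nsmul_mem hsumL N
  have hNk : N • (c + act σ c) ∈ kernel (Valued.v (R := PadicAlgCl p)) (genFibΩ p M) :=
    (kernel (Valued.v (R := PadicAlgCl p)) (genFibΩ p M)).nsmul_mem hsumk N
  have h2L : (2 : ℕ) • c₁ ∈ subfieldPoints (genFibΩ p M) (layer p m).toSubfield coeffs_mem_layer :=
    (subfieldPoints _ _ _).nsmul_mem hc₁L' 2
  have h2k : (2 : ℕ) • c₁ ∈ kernel (Valued.v (R := PadicAlgCl p)) (genFibΩ p M) :=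
    (kernel (Valued.v (R := PadicAlgCl p)) (genFibΩ p M)).nsmul_mem hc₁k 2
  have hDk : N • (c + act σ c) - (2 : ℕ) • c₁ ∈ kernel (Valued.v (R := PadicAlgCl p)) (genFibΩ p M) :=
    (kernel (Valued.v (R := PadicAlgCl p)) (genFibΩ p M)).sub_mem hNk h2k
  rw [ptLogΩ_act act hact0 hact τ (norm_zCoord_lt_one_of_mem_kernel hDk),
    ptLogΩ_sub (m := m) hNL h2L hNk h2k, ptLogΩ_nsmul (m := m) hsumL hsumk, ptLogΩ_nsmul (m := m) hc₁L' hc₁k,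
    ptLogΩ_add (m := m) hcL hσcL hck hσck, ptLogΩ_act act hact0 hact σ (norm_zCoord_lt_one_of_mem_kernel hck), hcℓ, hc₁ℓ]
  push_cast
  ring_nf

/-- **The Galois conjugate of the ♭ logarithm combination in twisted form**: for `σ` an inverter of `ζ_m` and `τ` with `τ ζ_m = ζ_m^a`
(`m ≥ 1`), `τ • (N(ℓ_m(x) + σ•ℓ_m(x)) − 2ℓ_1(x)) = N(ℓ_m^{(a)}(x) + ℓ_m^{(−a)}(x)) − 2·x_0(ζ_1^a − 1)`. [cite: Kobayashi2003, Prop. 8.26] -/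
theorem smul_flatLog_eq_twisted (x : ℕ → ℚ_[p]) (N : ℕ) {m : ℕ} (hm : 1 ≤ m) [NeZero (p ^ m)]
    {σ τ : Field.absoluteGaloisGroup ℚ_[p]} (hσ : σ • zeta p m = (zeta p m)⁻¹) {a : ZMod (p ^ m)}
    (hτ : τ • zeta p m = zeta p m ^ a.val) :
    τ • ((N : PadicAlgCl p) * ((∑ k ∈ range m, algebraMap ℚ_[p] (PadicAlgCl p) (x k) * (zeta p (m - k) - 1)) +
            σ • ∑ k ∈ range m, algebraMap ℚ_[p] (PadicAlgCl p) (x k) * (zeta p (m - k) - 1)) -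
          2 * ∑ k ∈ range 1, algebraMap ℚ_[p] (PadicAlgCl p) (x k) * (zeta p (1 - k) - 1)) =
      (N : PadicAlgCl p) * ((∑ k ∈ range m, algebraMap ℚ_[p] (PadicAlgCl p) (x k) * (zeta p (m - k) ^ a.val - 1)) +
            ∑ k ∈ range m, algebraMap ℚ_[p] (PadicAlgCl p) (x k) * (zeta p (m - k) ^ (-a).val - 1)) -
        2 * (algebraMap ℚ_[p] (PadicAlgCl p) (x 0) * (zeta p 1 ^ a.val - 1)) := by
  have h1 := smul_sprungEll_eq_twisted x τ m hτ
  have h2 : τ • (σ • ∑ k ∈ range m, algebraMap ℚ_[p] (PadicAlgCl p) (x k) * (zeta p (m - k) - 1)) =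
      ∑ k ∈ range m, algebraMap ℚ_[p] (PadicAlgCl p) (x k) * (zeta p (m - k) ^ (-a).val - 1) := by
    rw [← mul_smul]; exact mul_inverter_smul_sprungEll_eq_twisted x hσ hτ
  have hτ1 : τ • zeta p 1 = zeta p 1 ^ a.val := by
    have e1 : zeta p 1 = zeta p m ^ p ^ (m - 1) := by
      rw [SprungHonda.zeta_pow_prime_pow, show m - (m - 1) = 1 by omega]
    rw [e1, smul_pow', hτ, ← pow_mul, ← pow_mul, mul_comm]
  have h3 : τ • (∑ k ∈ range 1, algebraMap ℚ_[p] (PadicAlgCl p) (x k) * (zeta p (1 - k) - 1)) =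
      algebraMap ℚ_[p] (PadicAlgCl p) (x 0) * (zeta p 1 ^ a.val - 1) := by
    rw [smul_sprungEll_eq_twisted x τ 1 hτ1, Finset.sum_range_one]
  rw [Field.absoluteGaloisGroup.smul_def] at h1 h2 h3 ⊢
  rw [map_sub, map_mul, map_mul, map_add, map_natCast, map_ofNat, h1, h2, h3]

/-- **The character sum of the logarithms of the Galois orbit of `N•(c + σ•c) − 2•c₁`** (Kobayashi Prop. 8.26 for a general Honda type, any
`p`, `m ≥ 2`): with `act`, `c`, `c₁`, `σ` (an inverter of `ζ_m`) as above, `Λ(c) = ℓ_m(x)`, `Λ(c₁) = ℓ_1(x)`, and ANY family `τ_a` with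
`τ_a ζ_m = ζ_m^a` on units, for every primitive `ψ` modulo `p^m`: `∑_a ψ(a)·Λ(act τ_a (N•(c + act σ c) − 2•c₁)) = N·x_0·(1 + ψ(−1))·τ(ψ)`.
K3's `HondaLog.sum_mul_ptLogΩ_act_plusPoint_eq` is `N = 3`, Kobayashi's `x`. [cite: Kobayashi2003, Prop. 8.26 (p. 25)] [cite: Sprung2012, Lemma 2.3] -/
theorem sum_mul_ptLogΩ_act_flatPoint_eq (x : ℕ → ℚ_[p]) (N : ℕ)
    (act : Field.absoluteGaloisGroup ℚ_[p] → (genFibΩ p M).toAffine.Point → (genFibΩ p M).toAffine.Point)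
    (hact0 : ∀ σ, act σ 0 = 0)
    (hact : ∀ σ (x y : PadicAlgCl p) (h : (genFibΩ p M).toAffine.Nonsingular x y),
      ∃ h', act σ (Affine.Point.some x y h) = Affine.Point.some (σ • x) (σ • y) h')
    {m : ℕ} (hm : 2 ≤ m) [NeZero (p ^ m)] {σ : Field.absoluteGaloisGroup ℚ_[p]} (hσ : σ • zeta p m = (zeta p m)⁻¹)
    (τ : ZMod (p ^ m) → Field.absoluteGaloisGroup ℚ_[p]) (hτ : ∀ a : ZMod (p ^ m), IsUnit a → τ a • zeta p m = zeta p m ^ a.val)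
    {c c₁ : (genFibΩ p M).toAffine.Point}
    (hcL : c ∈ subfieldPoints (genFibΩ p M) (layer p m).toSubfield coeffs_mem_layer)
    (hck : c ∈ kernel (Valued.v (R := PadicAlgCl p)) (genFibΩ p M))
    (hcℓ : ptLogΩ p M c = ∑ k ∈ range m, algebraMap ℚ_[p] (PadicAlgCl p) (x k) * (zeta p (m - k) - 1))
    (hc₁L : c₁ ∈ subfieldPoints (genFibΩ p M) (layer p 1).toSubfield coeffs_mem_layer)
    (hc₁k : c₁ ∈ kernel (Valued.v (R := PadicAlgCl p)) (genFibΩ p M))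
    (hc₁ℓ : ptLogΩ p M c₁ = ∑ k ∈ range 1, algebraMap ℚ_[p] (PadicAlgCl p) (x k) * (zeta p (1 - k) - 1))
    (ψ : DirichletCharacter (PadicAlgCl p) (p ^ m)) (hψ : ψ.IsPrimitive) :
    ∑ a : ZMod (p ^ m), ψ a * ptLogΩ p M (act (τ a) (N • (c + act σ c) - (2 : ℕ) • c₁)) =
      (N : PadicAlgCl p) * algebraMap ℚ_[p] (PadicAlgCl p) (x 0) * (1 + ψ (-1)) *
        gaussSum ψ (AddChar.zmodChar (p ^ m) (zeta_pow_prime_pow_self (p := p) m)) := by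
  rw [← sum_mul_flatLog_eq x N hm ψ hψ]
  refine Finset.sum_congr rfl fun a _ ↦ ?_
  by_cases ha : IsUnit a
  · rw [ptLogΩ_act_flatPoint act hact0 hact σ (τ a) N (by omega) hcL hck hcℓ hc₁L hc₁k hc₁ℓ,
      smul_flatLog_eq_twisted x N (by omega) hσ (hτ a ha)]
  · rw [MulChar.map_nonunit ψ ha, zero_mul, zero_mul]

end PlusPoint

end Summit.BirchSwinnertonDyer.BirchSwinnertonDyer.Theorems.SSFlatERL

end
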